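import Literature.NumberTheory.Automorphic.UnitaryTwoTreeActionStabilizers   -- ★ B-p08 (g28) (W2): `glVertexAct_eq_self_iff`, `units_map_scalar_mul_comm`, `coe_units_map_scalar` (+ ★ `glVertexAct`, `glVertexAct_mul`, `glVertexAct_one`)
import Literature.NumberTheory.Automorphic.SLTwoTreeQuadraticTorusFixedShells   -- ★ A-p17 (g23) (W′1) part I: `quadTorus_mul_comm`, `quadTorus_inv_mul_mul_eq`, `coe_inv_mul_torus_mul_of_coe_eq_diagonal`, `glVertexAct_torus_shell_eq_iff` (imports ★ p843859 (W′3-alg))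
import HarnessLib

/-!
# The value of a class function at a torus-fixed vertex of the tree of `SL₂(F)`: it depends only on the SHELL (Labesse–Langlands 1979 §2 (2.1) — the tree-reading half)

Topic `NumberTheory/Automorphic`; namespace `Literature.NumberTheory.Automorphic.HermitianLatticeTree` (ROAD W's).  THEOREMS ONLY (no definition, no instance, no notation,
no named fact, no `sorry`).  Cell `pub/hodgecm-mathlib` (D-0151), crux H413 = `stmt-HodgeConjecture-24833`; road «R1LL-WILD» = «W′» (A-p12 (g19) census 822e2006 §2, LEAD
F0P3a-plan (g10) WORD T9-22 (4): opportunistic bricks, zero architect time), brick **(W′3) «LEMMA U′-wild = LL (2.1): the class of `γ` at a shell-`m` vertex»**, F0P3a-p08 (g15);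
algebra half ★ p843859 `LocalFields/QuadraticOrderRegularRepShells`; neighbours (W′1) ★ A-p17 (g23) `SLTwoTreeQuadraticTorusFixedShells` (fixed shells; imported) + part II (shell decomposition), (W′2) B-p14 (g33)
«weighted unfolding on a transitive action» (the `hval` socket below), (W′4) ★ A-p12 `UltrametricCharacterShellIntegral`, (W′6) A-p12 assembly.  HONEST LABEL: HC_CM is proved only
modulo the printed citations (the 2 remaining named inputs hLiu418, h413) until rung 0 closes; nothing printed is asserted here (group bookkeeping + 2×2 algebra over a valued field).

THE POINT (LL79 §2 p. 8, formula (2.1)).  `G = GL₂(F)` acts on the vertices of the tree `X` of `SL₂(F)` through `PGL₂(F)` (★ `glVertexAct`, ROAD W (W1c)); the stabiliser of the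
root `v₀ = [𝒪²]` is `F^×·GL₂(𝒪)` (★ `glVertexAct_eq_self_iff`).  Hence for a function `φ` on `G` invariant under conjugation by `GL₂(𝒪)` (scalars being central), the value
`φ(g⁻¹ γ g)` depends on `g` ONLY THROUGH THE VERTEX `g·v₀` (§1–§2) — this is exactly the `hval` hypothesis of (W′2)'s `…_of_vertexAction` unfolding, discharged for EVERY `g`
(fixed or not).  For a torus element `γ = (a, bv; b, a+bu)` (the regular representation of `a + bτ`, `τ² = uτ + v`, LL p. 7) and a shell-`m` vertex `x = (t·g_m)·v₀`
(`t` in the torus, `g_m = diag(1, ϖ^m)`, LL p. 8; (W′1) proves every vertex is of this form with `m` unique), the value is `φ(g_m⁻¹ γ g_m)` = `φ` of LL (2.1)'s matrix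
`(a, b v ϖ^m; b ϖ^{−m}, a + b u)` (§3) — «the class of `γ` at a shell-`m` vertex».  §4 bounds that matrix: it is the SCALAR `a` up to entries of size `|b|·|ϖ|^{−m}` (deep
shells see only the centre — LL p. 9) and it varies with `γ` only through `(a, b ϖ^{−m})` (window classes are locally constant in `γ`) — dyadic-safe: no `2`, no residue squares.

CONTENTS
* §1 `exists_units_mul_glInt_of_glVertexAct_eq` — `g·v₀ = g′·v₀ ⇒ g′ = g·(c·1)·k`, `c ∈ F^×`, `k ∈ GL₂(𝒪)`.
* §2 **`apply_conj_eq_of_glVertexAct_eq`** — for `φ` `GL₂(𝒪)`-conjugation-invariant: `g·v₀ = g′·v₀ ⇒ φ(g′⁻¹ γ g′) = φ(g⁻¹ γ g)` (every `γ`); the (W′2) `hval` discharge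
  `apply_conj_eq_apply_conj_section` for any section of the orbit map.
* §3 **`apply_conj_eq_apply_shellConj`** — at a shell-`m` vertex the value is `φ(g_m⁻¹ γ g_m)`, whose matrix is `(a, b v ϖ^m; b (ϖ^m)⁻¹, a + b u)` (★ A-p17's
  `coe_inv_mul_torus_mul_of_coe_eq_diagonal`); `torus_mul_inv_mul_mul` (`(t g)⁻¹ γ (t g) = g⁻¹ γ g`).
* §4 `forall_valuation_shellConj_sub_scalar_le` («deep shells see the scalar `a`»: every entry of `(2.1) − a·1` has valuation `≤ |b (ϖ^m)⁻¹|`) and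
  `forall_valuation_shellConj_sub_shellConj_le` («window classes»: entries of `(2.1)(a,b) − (2.1)(a′,b′)` have valuation `≤ max |a − a′| |b(ϖ^m)⁻¹ − b′(ϖ^m)⁻¹|`).

## References
* [LabesseLanglands1979] J.-P. Labesse, R. P. Langlands, *L-indistinguishability for SL(2)*, Canad. J. Math. 31 (1979) 726–785: §2 p. 7 (matrix of `a + bτ`), p. 8 (double cosets
  `T(F)∖G(F)∕G(𝒪_F)` with representatives `diag(1, ϖ^m)`, formula (2.1)), p. 9 (deep shells ∕ window).
* [Serre1980Trees] J.-P. Serre, *Trees* (1980), Ch. II §1.1–§1.3 (the tree of `SL₂`, `GL₂` acting through `PGL₂`, `Stab(𝒪²) = F^×·GL₂(𝒪)`).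
-/

set_option autoImplicit false

noncomputable section

open scoped ValuativeRel Matrix MatrixGroups
open Matrix ValuativeRel

namespace Literature.NumberTheory.Automorphic.HermitianLatticeTree

open Literature.NumberTheory.Automorphic Literature.NumberTheory.LocalFields

variable {F : Type*} [Field F] [ValuativeRel F] {ϖ : F} (hϖ : IsUniformizingElement ϖ) [IsDiscreteValuationRing 𝒪[F]]

/-! ## §1 Two group elements with the same vertex differ by the stabiliser `F^×·GL₂(𝒪)` -/

include hϖ in
/-- **Same vertex ⇒ same coset modulo `F^×·GL₂(𝒪)`**: if `g·v₀ = g′·v₀` (`v₀ = [𝒪²]`) then `g′ = g·(c·1)·k` with `c ∈ F^×`, `k ∈ GL₂(𝒪)` (Serre: `Stab(v₀) = F^×·GL₂(𝒪)`;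
★ `glVertexAct_eq_self_iff` at `h = 1` applied to `g⁻¹ g′`). [cite: Serre1980Trees, Ch. II §1.3] [cite: LabesseLanglands1979, §2 p. 8] -/
theorem exists_units_mul_glInt_of_glVertexAct_eq (g g' : GL (Fin 2) F)
    (v₀ : {M : Submodule 𝒪[F] (Fin 2 → F) // IsSpecialLattice (RingHom.id F) ϖ !![(0 : F), 1; -1, 0] M})
    (hv₀ : v₀.1 = latt (1 : Matrix (Fin 2) (Fin 2) F)) (h : glVertexAct hϖ g v₀ = glVertexAct hϖ g' v₀) :
    ∃ (c : Fˣ) (k : GL (Fin 2) F), k ∈ glInt 2 F ∧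
      g' = g * (c.map ((Matrix.scalar (Fin 2) : F →+* Matrix (Fin 2) (Fin 2) F) : F →* Matrix (Fin 2) (Fin 2) F) * k) := by
  have h1 : glVertexAct hϖ (g⁻¹ * g') v₀ = v₀ := by
    rw [glVertexAct_mul, ← h, ← glVertexAct_mul, inv_mul_cancel, glVertexAct_one]
  have hv₀' : v₀.1 = latt ((1 : GL (Fin 2) F) : Matrix (Fin 2) (Fin 2) F) := by
    rw [Units.val_one]; exact hv₀
  obtain ⟨c, k, hk, hck⟩ := (glVertexAct_eq_self_iff hϖ 1 v₀ hv₀' (g⁻¹ * g')).1 h1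
  refine ⟨c, k, hk, ?_⟩
  rw [inv_one, one_mul, mul_one] at hck
  rw [← hck, mul_inv_cancel_left]

/-! ## §2 The value of a `GL₂(𝒪)`-class function at `g⁻¹ γ g` depends only on the vertex `g·v₀` -/

omit [ValuativeRel F] [IsDiscreteValuationRing 𝒪[F]] in
/-- Scalars are central: `(c·1)⁻¹ y (c·1) = y`. [cite: Serre1980Trees, Ch. II §1.2] -/
theorem units_map_scalar_inv_mul_mul (c : Fˣ) (y : GL (Fin 2) F) :
    (c.map ((Matrix.scalar (Fin 2) : F →+* Matrix (Fin 2) (Fin 2) F) : F →* Matrix (Fin 2) (Fin 2) F))⁻¹ * y *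
      c.map ((Matrix.scalar (Fin 2) : F →+* Matrix (Fin 2) (Fin 2) F) : F →* Matrix (Fin 2) (Fin 2) F) = y := by
  rw [mul_assoc, ← units_map_scalar_mul_comm c y, inv_mul_cancel_left]

include hϖ in
/-- **VALUE LAW ON VERTICES** (the tree-reading of LL (2.1)): for `φ : GL₂(F) → X` invariant under conjugation by `GL₂(𝒪)` and ANY `γ`, the value `φ(g⁻¹ γ g)` depends on `g`
only through the vertex `g·v₀`: `g·v₀ = g′·v₀ ⇒ φ(g′⁻¹ γ g′) = φ(g⁻¹ γ g)` (by §1, `g′ = g·(c·1)·k`, scalars are central and `k` conjugates away).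
[cite: LabesseLanglands1979, §2 (2.1) p. 8] [cite: Serre1980Trees, Ch. II §1.3] -/
theorem apply_conj_eq_of_glVertexAct_eq {X : Sort*} (φ : GL (Fin 2) F → X) (hφ : ∀ k : GL (Fin 2) F, k ∈ glInt 2 F → ∀ y : GL (Fin 2) F, φ (k⁻¹ * y * k) = φ y)
    (γ g g' : GL (Fin 2) F) (v₀ : {M : Submodule 𝒪[F] (Fin 2 → F) // IsSpecialLattice (RingHom.id F) ϖ !![(0 : F), 1; -1, 0] M})
    (hv₀ : v₀.1 = latt (1 : Matrix (Fin 2) (Fin 2) F)) (h : glVertexAct hϖ g v₀ = glVertexAct hϖ g' v₀) :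
    φ (g'⁻¹ * γ * g') = φ (g⁻¹ * γ * g) := by
  obtain ⟨c, k, hk, rfl⟩ := exists_units_mul_glInt_of_glVertexAct_eq hϖ g g' v₀ hv₀ h
  have e : (g * (c.map ((Matrix.scalar (Fin 2) : F →+* Matrix (Fin 2) (Fin 2) F) : F →* Matrix (Fin 2) (Fin 2) F) * k))⁻¹ * γ *
        (g * (c.map ((Matrix.scalar (Fin 2) : F →+* Matrix (Fin 2) (Fin 2) F) : F →* Matrix (Fin 2) (Fin 2) F) * k)) =
      k⁻¹ * ((c.map ((Matrix.scalar (Fin 2) : F →+* Matrix (Fin 2) (Fin 2) F) : F →* Matrix (Fin 2) (Fin 2) F))⁻¹ * (g⁻¹ * γ * g) *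
        c.map ((Matrix.scalar (Fin 2) : F →+* Matrix (Fin 2) (Fin 2) F) : F →* Matrix (Fin 2) (Fin 2) F)) * k := by
    simp only [_root_.mul_inv_rev, mul_assoc]
  rw [e, units_map_scalar_inv_mul_mul, hφ k hk]

include hϖ in
/-- **THE (W′2) `hval` DISCHARGE** (B-p14 (g33)'s `…_of_vertexAction` socket, section form): for ANY section `s` of the orbit map (`s x · v₀ = x`) and `φ`
`GL₂(𝒪)`-conjugation-invariant, `φ(g⁻¹ γ g) = φ((s (g·v₀))⁻¹ γ (s (g·v₀)))` for EVERY `g` — so `val x := φ((s x)⁻¹ γ (s x))` is a well-defined value on vertices.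
[cite: LabesseLanglands1979, §2 (2.1) p. 8] [cite: Serre1980Trees, Ch. II §1.3] -/
theorem apply_conj_eq_apply_conj_section {X : Sort*} (φ : GL (Fin 2) F → X) (hφ : ∀ k : GL (Fin 2) F, k ∈ glInt 2 F → ∀ y : GL (Fin 2) F, φ (k⁻¹ * y * k) = φ y)
    (γ : GL (Fin 2) F) (v₀ : {M : Submodule 𝒪[F] (Fin 2 → F) // IsSpecialLattice (RingHom.id F) ϖ !![(0 : F), 1; -1, 0] M})
    (hv₀ : v₀.1 = latt (1 : Matrix (Fin 2) (Fin 2) F))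
    (s : {M : Submodule 𝒪[F] (Fin 2 → F) // IsSpecialLattice (RingHom.id F) ϖ !![(0 : F), 1; -1, 0] M} → GL (Fin 2) F)
    (hs : ∀ x, glVertexAct hϖ (s x) v₀ = x) (g : GL (Fin 2) F) :
    φ (g⁻¹ * γ * g) = φ ((s (glVertexAct hϖ g v₀))⁻¹ * γ * s (glVertexAct hϖ g v₀)) :=
  apply_conj_eq_of_glVertexAct_eq hϖ φ hφ γ (s (glVertexAct hϖ g v₀)) g v₀ hv₀ (hs _)

/-! ## §3 At a shell-`m` vertex the value is `φ` of LL (2.1)'s matrix -/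

omit [ValuativeRel F] [IsDiscreteValuationRing 𝒪[F]] in
/-- `(t g)⁻¹ γ (t g) = g⁻¹ γ g` for `t` in the torus of `γ` (the torus is abelian). [cite: LabesseLanglands1979, §2 p. 8] -/
theorem torus_mul_inv_mul_mul {u v a b c d : F} {γ t : GL (Fin 2) F} (hγ : (γ : Matrix (Fin 2) (Fin 2) F) = !![a, b * v; b, a + b * u])
    (ht : (t : Matrix (Fin 2) (Fin 2) F) = !![c, d * v; d, c + d * u]) (g : GL (Fin 2) F) : (t * g)⁻¹ * γ * (t * g) = g⁻¹ * γ * g := by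
  rw [_root_.mul_inv_rev, show g⁻¹ * t⁻¹ * γ * (t * g) = g⁻¹ * (t⁻¹ * (γ * t)) * g by simp only [mul_assoc], quadTorus_mul_comm hγ ht,
    inv_mul_cancel_left]

include hϖ in
/-- **THE VALUE AT A SHELL-`m` VERTEX** (LL (2.1) read on the tree): for `φ` `GL₂(𝒪)`-conjugation-invariant, a torus element `γ = (a, bv; b, a+bu)`, ANY torus element `t`,
`g_m = diag(1, ϖ^m)`, and ANY `g` with `g·v₀ = (t g_m)·v₀` (a vertex of shell `m`; (W′1): every vertex is such, `m` unique): `φ(g⁻¹ γ g) = φ(g_m⁻¹ γ g_m)`, whose argument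
has matrix `(a, b v ϖ^m; b (ϖ^m)⁻¹, a + b u)`. [cite: LabesseLanglands1979, §2 (2.1) p. 8] [cite: Serre1980Trees, Ch. II §1.3] -/
theorem apply_conj_eq_apply_shellConj {X : Sort*} (φ : GL (Fin 2) F → X) (hφ : ∀ k : GL (Fin 2) F, k ∈ glInt 2 F → ∀ y : GL (Fin 2) F, φ (k⁻¹ * y * k) = φ y)
    {u v a b c d : F} {γ t gm g : GL (Fin 2) F} (hγ : (γ : Matrix (Fin 2) (Fin 2) F) = !![a, b * v; b, a + b * u])
    (ht : (t : Matrix (Fin 2) (Fin 2) F) = !![c, d * v; d, c + d * u]) {m : ℕ} (hgm : (gm : Matrix (Fin 2) (Fin 2) F) = Matrix.diagonal ![1, ϖ ^ m])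
    (v₀ : {M : Submodule 𝒪[F] (Fin 2 → F) // IsSpecialLattice (RingHom.id F) ϖ !![(0 : F), 1; -1, 0] M})
    (hv₀ : v₀.1 = latt (1 : Matrix (Fin 2) (Fin 2) F)) (hg : glVertexAct hϖ g v₀ = glVertexAct hϖ (t * gm) v₀) :
    φ (g⁻¹ * γ * g) = φ (gm⁻¹ * γ * gm) ∧
      ((gm⁻¹ * γ * gm : GL (Fin 2) F) : Matrix (Fin 2) (Fin 2) F) = !![a, b * v * ϖ ^ m; b * (ϖ ^ m)⁻¹, a + b * u] := by
  refine ⟨?_, coe_inv_mul_torus_mul_of_coe_eq_diagonal u v a b hγ hgm (pow_ne_zero m hϖ.ne_zero)⟩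
  rw [apply_conj_eq_of_glVertexAct_eq hϖ φ hφ γ (t * gm) g v₀ hv₀ hg.symm, torus_mul_inv_mul_mul hγ ht]

/-! ## §4 The shell matrix is the scalar `a` up to `|b|·|ϖ|^{−m}`; window classes depend on `(a, b ϖ^{−m})` only -/

omit [IsDiscreteValuationRing 𝒪[F]] in
/-- **DEEP SHELLS SEE THE CENTRE** (LL p. 9): with `u, v` integral and `|ϖ| ≤ 1`, every entry of `(a, b v ϖ^m; b (ϖ^m)⁻¹, a + b u) − a·1` has valuation `≤ |b (ϖ^m)⁻¹|` —
so on the shells `m ≤ ord b − j` the matrix of `γ` at a shell-`m` vertex is congruent to the SCALAR `a` modulo `ϖ^j`. [cite: LabesseLanglands1979, §2 p. 9] -/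
theorem forall_valuation_shellConj_sub_scalar_le {u v : F} (hu : u ∈ 𝒪[F]) (hv : v ∈ 𝒪[F]) (hϖ0 : ϖ ≠ 0) (hϖ1 : valuation F ϖ ≤ 1) (m : ℕ) (a b : F) :
    ∀ i j, valuation F ((!![a, b * v * ϖ ^ m; b * (ϖ ^ m)⁻¹, a + b * u] - a • (1 : Matrix (Fin 2) (Fin 2) F)) i j) ≤ valuation F (b * (ϖ ^ m)⁻¹) := by
  have hm : ϖ ^ m ≠ 0 := pow_ne_zero m hϖ0
  have hϖm : valuation F (ϖ ^ m) ≤ 1 := by rw [map_pow]; exact pow_le_one' hϖ1 m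
  have hu' := (Valuation.mem_integer_iff _ _).1 hu
  have hv' := (Valuation.mem_integer_iff _ _).1 hv
  -- `|b| ≤ |b (ϖ^m)⁻¹|` since `|ϖ^m| ≤ 1`
  have hb : valuation F b ≤ valuation F (b * (ϖ ^ m)⁻¹) := by
    have h : b = b * (ϖ ^ m)⁻¹ * ϖ ^ m := by rw [inv_mul_cancel_right₀ hm]
    calc valuation F b = valuation F (b * (ϖ ^ m)⁻¹) * valuation F (ϖ ^ m) := by rw [← map_mul, ← h]
      _ ≤ valuation F (b * (ϖ ^ m)⁻¹) * 1 := mul_le_mul' le_rfl hϖm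
      _ = valuation F (b * (ϖ ^ m)⁻¹) := mul_one _
  intro i j
  fin_cases i <;> fin_cases j
  · simp
  · show valuation F (b * v * ϖ ^ m - a • (0 : F)) ≤ valuation F (b * (ϖ ^ m)⁻¹)
    rw [smul_zero, sub_zero, map_mul, map_mul]
    calc valuation F b * valuation F v * valuation F (ϖ ^ m) ≤ valuation F (b * (ϖ ^ m)⁻¹) * 1 * 1 :=
          mul_le_mul' (mul_le_mul' hb hv') hϖm
      _ = valuation F (b * (ϖ ^ m)⁻¹) := by rw [mul_one, mul_one]
  · show valuation F (b * (ϖ ^ m)⁻¹ - a • (0 : F)) ≤ valuation F (b * (ϖ ^ m)⁻¹)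
    rw [smul_zero, sub_zero]
  · show valuation F (a + b * u - a • (1 : F)) ≤ valuation F (b * (ϖ ^ m)⁻¹)
    rw [smul_eq_mul, mul_one, add_sub_cancel_left, map_mul]
    calc valuation F b * valuation F u ≤ valuation F (b * (ϖ ^ m)⁻¹) * 1 := mul_le_mul' hb hu'
      _ = valuation F (b * (ϖ ^ m)⁻¹) := mul_one _

omit [IsDiscreteValuationRing 𝒪[F]] in
/-- **WINDOW CLASSES DEPEND ON `(a, b ϖ^{−m})` ONLY**: with `u, v` integral and `|ϖ| ≤ 1`, every entry of `(2.1)(a, b) − (2.1)(a′, b′)` at shell `m` has valuation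
`≤ max |a − a′| |b (ϖ^m)⁻¹ − b′ (ϖ^m)⁻¹|` — so the `GL₂(𝒪)`-class modulo `ϖ^j` of `γ` at a shell-`m` vertex is locally constant in `γ` (the dyadic-safe replacement of the tame
road's «bit»: no `2`, no residue squares). [cite: LabesseLanglands1979, §2 (2.1) p. 8; p. 9] -/
theorem forall_valuation_shellConj_sub_shellConj_le {u v : F} (hu : u ∈ 𝒪[F]) (hv : v ∈ 𝒪[F]) (hϖ0 : ϖ ≠ 0) (hϖ1 : valuation F ϖ ≤ 1) (m : ℕ)
    (a b a' b' : F) :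
    ∀ i j, valuation F ((!![a, b * v * ϖ ^ m; b * (ϖ ^ m)⁻¹, a + b * u] - !![a', b' * v * ϖ ^ m; b' * (ϖ ^ m)⁻¹, a' + b' * u]) i j) ≤
      max (valuation F (a - a')) (valuation F (b * (ϖ ^ m)⁻¹ - b' * (ϖ ^ m)⁻¹)) := by
  have hm : ϖ ^ m ≠ 0 := pow_ne_zero m hϖ0
  have hϖm : valuation F (ϖ ^ m) ≤ 1 := by rw [map_pow]; exact pow_le_one' hϖ1 m
  have hu' := (Valuation.mem_integer_iff _ _).1 hu
  have hv' := (Valuation.mem_integer_iff _ _).1 hv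
  -- `b − b′ = (b(ϖ^m)⁻¹ − b′(ϖ^m)⁻¹)·ϖ^m`, so `|b − b′| ≤ |b(ϖ^m)⁻¹ − b′(ϖ^m)⁻¹|`
  have hbb : b - b' = (b * (ϖ ^ m)⁻¹ - b' * (ϖ ^ m)⁻¹) * ϖ ^ m := by field_simp
  have hbb' : valuation F (b - b') ≤ valuation F (b * (ϖ ^ m)⁻¹ - b' * (ϖ ^ m)⁻¹) := by
    rw [hbb, map_mul]
    calc valuation F (b * (ϖ ^ m)⁻¹ - b' * (ϖ ^ m)⁻¹) * valuation F (ϖ ^ m) ≤ valuation F (b * (ϖ ^ m)⁻¹ - b' * (ϖ ^ m)⁻¹) * 1 := mul_le_mul' le_rfl hϖm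
      _ = _ := mul_one _
  intro i j
  fin_cases i <;> fin_cases j
  · show valuation F (a - a') ≤ _
    exact le_max_left _ _
  · show valuation F (b * v * ϖ ^ m - b' * v * ϖ ^ m) ≤ _
    have h : b * v * ϖ ^ m - b' * v * ϖ ^ m = (b - b') * (v * ϖ ^ m) := by ring
    rw [h, map_mul, map_mul]
    calc valuation F (b - b') * (valuation F v * valuation F (ϖ ^ m)) ≤ valuation F (b * (ϖ ^ m)⁻¹ - b' * (ϖ ^ m)⁻¹) * 1 :=
          mul_le_mul' hbb' (mul_le_one' hv' hϖm)
      _ ≤ _ := by rw [mul_one]; exact le_max_right _ _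
  · show valuation F (b * (ϖ ^ m)⁻¹ - b' * (ϖ ^ m)⁻¹) ≤ _
    exact le_max_right _ _
  · show valuation F (a + b * u - (a' + b' * u)) ≤ _
    have h : a + b * u - (a' + b' * u) = (a - a') + (b - b') * u := by ring
    rw [h]
    refine le_trans (Valuation.map_add _ _ _) (max_le_max le_rfl ?_)
    rw [map_mul]
    calc valuation F (b - b') * valuation F u ≤ valuation F (b * (ϖ ^ m)⁻¹ - b' * (ϖ ^ m)⁻¹) * 1 := mul_le_mul' hbb' hu'
      _ = _ := mul_one _

end Literature.NumberTheory.Automorphic.HermitianLatticeTree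

end
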